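import Summits.QuantumFields.QCD.Theorems.PauliWegnerSeaChiralGluonicCompletionRestrict

/-!
# Crux `ChiralGluonicCompletion` (stmt-QuantumFields-17498), line `Sketch` — the skeleton of the crux AFTER the recommended
# re-type (`reg.IsChiralAtZero ↦ reg.HasGoldstoneBound` in the hypothesis): two stubs, no chirality stub (lead cycle 5, 2026-08-17)

Cycles 2–5 of the line recommend re-typing the chiral input of the crux: in the hypothesis of `ChiralGluonicCompletion`
(and in the conclusions of the trajectory cruxes `ChiralMobilityGap` stmt-17497 / `ChiralOneScaleTrajectory` stmt-17512
that feed it) replace `reg.IsChiralAtZero ∧` by `reg.HasGoldstoneBound ∧` (Literature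
`QCDRegularisation.HasGoldstoneBound`, `QCDGoldstoneBound.lean`: the eventual Goldstone lower bound, the clause `G` of
`DiagonalSpine.ChiralTuning`; it implies `IsChiralAtZero` and, unlike it, is inherited by every subsequence).
`PauliWegnerSeaChiralGluonicCompletionRetype.lean` (p140961) proved that the re-typed crux closes modulo the line's stubs
C1 / C2' stated over the TYPED package `Hyp`.  This file proves the sharper statement the planner needs to file the re-typed
crux with its own two-stub skeleton: it closes modulo C1 / C2' stated over the RE-TYPED package itself (weaker stubs —
their hypothesis is stronger), with no third stub and no diagonal/selection step:

* `hypGoldstone_restrict` — the re-typed package `HasMassScaling ∧ HasGoldstoneBound ∧ HasAsymptoticScaling ∧ ∀ m > 0, PerMass`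
  passes to EVERY subsequence with no further input (all four conjuncts are tail properties; contrast `hyp_restrict`, which
  must be handed a Goldstone bound to regain the `∃ᶠ` pin);
* `chiralGluonicCompletionGoldstone_of_goldstoneStubs` (registered sub-goal) — C1_G (signed lattice gap of the given
  regularisation at every positive tuple, from the re-typed package) → C2'_G (one gap-conditioned subsequence carrying the
  continuum half at every positive tuple, from the re-typed package) → the re-typed crux: take C2'_G's subsequence `φ`
  (fed with C1_G's gap along `reg`), pass the package to `reg.restrict φ`, re-apply C1_G there, assemble with
  `body_of_parts`; the witness `reg.restrict φ` is chiral at zero by `HasGoldstoneBound.isChiralAtZero`.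
So after the re-type the crux is EXACTLY "FullLatticeGap + LatticeToContinuum for the given regularisation at the chiral
line" (C1_G ∧ C2'_G), the honest Yang–Mills-hard content, and nothing else.
-/

noncomputable section

namespace Summit.QuantumFields.QCD.Theorems.StronglyChiralSubsequence

open MeasureTheory Filter Topology
open Literature.MathematicalPhysics.QuantumFieldTheory Literature.MathematicalPhysics.QuantumLattice
  Literature.Probability.LatticeModels

variable {Nf : ℕ}

/-- **The re-typed package is hereditary along every subsequence, with no further input**: mass scaling, asymptotic
scaling and the per-mass clauses are tail properties (`…_restrict`, landed), and the Goldstone bound restricts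
(`HasGoldstoneBound.restrict`). -/
theorem hypGoldstone_restrict (reg : QCDRegularisation Nf) (φ : ℕ → ℕ) (hφ : StrictMono φ)
    (h : reg.HasMassScaling ∧ reg.HasGoldstoneBound ∧ (reg.scheme 0 0 0).HasAsymptoticScaling ∧
      ∀ m : Fin Nf → ℝ, (∀ f, 0 < m f) → PerMass Nf reg m) :
    (reg.restrict φ hφ.tendsto_atTop).HasMassScaling ∧ (reg.restrict φ hφ.tendsto_atTop).HasGoldstoneBound ∧
      ((reg.restrict φ hφ.tendsto_atTop).scheme 0 0 0).HasAsymptoticScaling ∧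
        ∀ m : Fin Nf → ℝ, (∀ f, 0 < m f) → PerMass Nf (reg.restrict φ hφ.tendsto_atTop) m :=
  ⟨hasMassScaling_restrict reg φ hφ h.1, h.2.1.restrict φ hφ.tendsto_atTop,
    hasAsymptoticScaling_restrict reg φ hφ h.2.2.1, fun m hm => perMass_restrict reg φ hφ m (h.2.2.2 m hm)⟩

/-- **The re-typed package implies the typed one** (`HasGoldstoneBound.isChiralAtZero`), so the re-typed crux is implied by
the crux as typed and every lemma over `Hyp` applies to a re-typed witness. -/
theorem hyp_of_hypGoldstone (reg : QCDRegularisation Nf)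
    (h : reg.HasMassScaling ∧ reg.HasGoldstoneBound ∧ (reg.scheme 0 0 0).HasAsymptoticScaling ∧
      ∀ m : Fin Nf → ℝ, (∀ f, 0 < m f) → PerMass Nf reg m) : Hyp Nf reg :=
  ⟨h.1, h.2.1.isChiralAtZero, h.2.2.1, h.2.2.2⟩

/-- **Registered sub-goal `chiralGluonicCompletionGoldstone_of_goldstoneStubs` — the two-stub skeleton of the RE-TYPED
crux.**  If (C1_G) every regularisation carrying the re-typed package has a signed lattice gap at every positive tuple,
and (C2'_G) every such regularisation with those gaps has ONE subsequence carrying the continuum half at every positive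
tuple, then the crux with `reg.HasGoldstoneBound` in place of `reg.IsChiralAtZero` holds: for `N_f ∈ {2,3}` a re-typed
witness completes to `QCDOf N_f`.  No chirality stub: the witness `reg.restrict φ` of `QCDOf` is chiral at zero because
the Goldstone bound restricts. -/
theorem chiralGluonicCompletionGoldstone_of_goldstoneStubs : (∀ Nf : ℕ, Nf = 2 ∨ Nf = 3 → ∀ reg : QCDRegularisation Nf, (reg.HasMassScaling ∧ reg.HasGoldstoneBound ∧ (reg.scheme 0 0 0).HasAsymptoticScaling ∧ ∀ m : Fin Nf → ℝ, (∀ f, 0 < m f) → PerMass Nf reg m) → ∀ m : Fin Nf → ℝ, (∀ f, 0 < m f) → ∃ Δ > 0, (reg.scheme m 0 0).HasLatticeMassGap Δ) → (∀ Nf : ℕ, Nf = 2 ∨ Nf = 3 → ∀ reg : QCDRegularisation Nf, (reg.HasMassScaling ∧ reg.HasGoldstoneBound ∧ (reg.scheme 0 0 0).HasAsymptoticScaling ∧ ∀ m : Fin Nf → ℝ, (∀ f, 0 < m f) → PerMass Nf reg m) → (∀ m : Fin Nf → ℝ, (∀ f, 0 < m f) → ∃ Δ > 0, (reg.scheme m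 0 0).HasLatticeMassGap Δ) → ∃ φ : ℕ → ℕ, ∃ hφ : StrictMono φ, ∀ m : Fin Nf → ℝ, (∀ f, 0 < m f) → ContinuumBody Nf (reg.restrict φ hφ.tendsto_atTop) m) → ∀ Nf : ℕ, Nf = 2 ∨ Nf = 3 → (∃ reg : QCDRegularisation Nf, reg.HasMassScaling ∧ reg.HasGoldstoneBound ∧ (reg.scheme 0 0 0).HasAsymptoticScaling ∧ ∀ m : Fin Nf → ℝ, (∀ f, 0 < m f) → PerMass Nf reg m) → QCDOf Nf := by
  rintro hC1 hC2 Nf hNf ⟨reg, hH⟩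
  -- C2'_G, fed with C1_G's gaps along `reg`: one subsequence carrying the continuum half at every positive tuple
  obtain ⟨φ, hφ, hcont⟩ := hC2 Nf hNf reg hH (hC1 Nf hNf reg hH)
  -- the re-typed package rides along `φ` with no further input; C1_G re-applied there gives the lattice gaps
  have hH₁ := hypGoldstone_restrict reg φ hφ hH
  exact ⟨reg.restrict φ hφ.tendsto_atTop, hH₁.1, hH₁.2.1.isChiralAtZero,
    fun m hm => body_of_parts _ m (hcont m hm) (hC1 Nf hNf _ hH₁ m hm)⟩

/-- **The typed stubs imply the re-typed ones** (the re-typed package is a `Hyp`-package, `hyp_of_hypGoldstone`): C1 over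
`Hyp` gives C1_G, so every slice of C1 already landed for the line (p138500, p139879) serves the re-typed skeleton verbatim.
(The re-typed CRUX is likewise implied by the typed one: `chiralGluonicCompletionGoldstone_of_crux`, `…Retype.lean`.) -/
theorem latticeGapGoldstone_of_latticeGap
    (hC1 : ∀ Nf : ℕ, Nf = 2 ∨ Nf = 3 → ∀ reg : QCDRegularisation Nf, Hyp Nf reg →
      ∀ m : Fin Nf → ℝ, (∀ f, 0 < m f) → ∃ Δ > 0, (reg.scheme m 0 0).HasLatticeMassGap Δ) :
    ∀ Nf : ℕ, Nf = 2 ∨ Nf = 3 → ∀ reg : QCDRegularisation Nf,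
      (reg.HasMassScaling ∧ reg.HasGoldstoneBound ∧ (reg.scheme 0 0 0).HasAsymptoticScaling ∧
        ∀ m : Fin Nf → ℝ, (∀ f, 0 < m f) → PerMass Nf reg m) →
      ∀ m : Fin Nf → ℝ, (∀ f, 0 < m f) → ∃ Δ > 0, (reg.scheme m 0 0).HasLatticeMassGap Δ :=
  fun Nf hNf reg hH => hC1 Nf hNf reg (hyp_of_hypGoldstone reg hH)

/-- Likewise C2' over `Hyp` gives C2'_G. -/
theorem continuumGoldstone_of_continuum
    (hC2 : ∀ Nf : ℕ, Nf = 2 ∨ Nf = 3 → ∀ reg : QCDRegularisation Nf, Hyp Nf reg →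
      (∀ m : Fin Nf → ℝ, (∀ f, 0 < m f) → ∃ Δ > 0, (reg.scheme m 0 0).HasLatticeMassGap Δ) →
        ∃ φ : ℕ → ℕ, ∃ hφ : StrictMono φ, ∀ m : Fin Nf → ℝ, (∀ f, 0 < m f) →
          ContinuumBody Nf (reg.restrict φ hφ.tendsto_atTop) m) :
    ∀ Nf : ℕ, Nf = 2 ∨ Nf = 3 → ∀ reg : QCDRegularisation Nf,
      (reg.HasMassScaling ∧ reg.HasGoldstoneBound ∧ (reg.scheme 0 0 0).HasAsymptoticScaling ∧
        ∀ m : Fin Nf → ℝ, (∀ f, 0 < m f) → PerMass Nf reg m) →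
      (∀ m : Fin Nf → ℝ, (∀ f, 0 < m f) → ∃ Δ > 0, (reg.scheme m 0 0).HasLatticeMassGap Δ) →
        ∃ φ : ℕ → ℕ, ∃ hφ : StrictMono φ, ∀ m : Fin Nf → ℝ, (∀ f, 0 < m f) →
          ContinuumBody Nf (reg.restrict φ hφ.tendsto_atTop) m :=
  fun Nf hNf reg hH => hC2 Nf hNf reg (hyp_of_hypGoldstone reg hH)

end Summit.QuantumFields.QCD.Theorems.StronglyChiralSubsequence

end
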